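import Literature.MathematicalPhysics.QuantumManyBody.CentreOfMassKineticEnergy
import Literature.MathematicalPhysics.QuantumManyBody.SwapPurity
import Mathlib.MeasureTheory.Group.LIntegral
import Mathlib.MeasureTheory.Integral.Prod
import Mathlib.MeasureTheory.Integral.IntervalIntegral.Basic
import Mathlib.Analysis.Normed.Group.Bounded
import HarnessLib

/-!
# Crux `RigidMomentumBound` (stmt-AtomisticToContinuum-13034), line `registered`:
# auxiliary lemmas for the smearing step `stub_smearStep` (part 1: shifts, Tonelli, arithmetic)

Supports (does not close) stmt-AtomisticToContinuum-13034. Generic bookkeeping for the rigid-smearing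
construction `Θ² = ∫₀^{2τ} |Φ(· - t𝟙ₐ)|² w(t) dt` of the registered line (`Cruxes/RigidMomentumBound/
Lines/registered.lean`):

* rigid shifts `X ↦ X - t • 𝟙ₐ` (`𝟙ₐ = (eₐ,…,eₐ)`): the Fréchet derivative of a shifted function, the
  shift invariance of the pair interaction, of the relative kinetic density and of the rigid
  derivatives, and the support bookkeeping `X ∉ Λ_{L₀+2τ}^N ⇒ X - t𝟙ₐ ∉ Λ_{L₀}^N` for `t ∈ [0, 2τ]`;
* Tonelli + translation invariance of Lebesgue measure on `(ℝ³)^N`: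
  `∫ dX ∫_S k(X - t𝟙) φ(t) dt = (∫_S φ) (∫ k)` (`lintegral_lintegral_shift`);
* a Cauchy–Schwarz bound for the square of the norm of a real integral in `ℝ≥0∞`;
* the `ℝ≥0∞` arithmetic of the final normalisation (`inv_mul_le_add_of_le`).

References: E. H. Lieb, M. Loss, *Analysis* (2001), Thm 7.8 (convexity inequality for gradients) for the
construction these lemmas serve; everything here is folklore.
-/

noncomputable section

open MeasureTheory Filter
open scoped ENNReal NNReal Topology

namespace Summit.AtomisticToContinuum.BoseEinsteinCondensation.Theorems.RigidMomentumBound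

open Literature.MathematicalPhysics.QuantumManyBody.BoseGas

namespace SmearStep

variable {N : ℕ}

/-! ### Rigid shifts -/

/-- The rigid unit direction `𝟙ₐ = (eₐ, …, eₐ) ∈ (ℝ³)^N`. We do not introduce a definition; this lemma
records that all its particle components are equal (used for permutation invariance). [folklore] -/
theorem rigid_comp_perm (a : Fin 3) (σ : Equiv.Perm (Fin N)) :
    ((fun _ : Fin N => EuclideanSpace.single a (1 : ℝ)) ∘ σ : Config N) =
      fun _ : Fin N => EuclideanSpace.single a (1 : ℝ) := rfl

/-- Shifting commutes with permuting the particles: `(X ∘ σ) - t𝟙ₐ = (X - t𝟙ₐ) ∘ σ`. [folklore] -/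
theorem comp_perm_sub_smul (X : Config N) (σ : Equiv.Perm (Fin N)) (t : ℝ) (a : Fin 3) :
    (X ∘ σ : Config N) - t • (fun _ : Fin N => EuclideanSpace.single a (1 : ℝ)) =
      (X - t • (fun _ : Fin N => EuclideanSpace.single a (1 : ℝ))) ∘ σ := by
  funext i
  simp

/-- Fréchet derivative of a shifted function: `D(f(· - c))(X) = Df(X - c)`. [folklore] -/
theorem fderiv_comp_sub_const' {E : Type*} [NormedAddCommGroup E] [NormedSpace ℝ E]
    {f : Config N → E} (hf : Differentiable ℝ f) (c X : Config N) :
    fderiv ℝ (fun Z : Config N => f (Z - c)) X = fderiv ℝ f (X - c) := by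
  have h : HasFDerivAt (fun Z : Config N => f (Z - c))
      ((fderiv ℝ f (X - c)).comp (ContinuousLinearMap.id ℝ (Config N))) X :=
    (hf (X - c)).hasFDerivAt.comp X ((hasFDerivAt_id X).sub_const c)
  rw [h.fderiv, ContinuousLinearMap.comp_id]

/-- A shifted `C¹` function is `C¹`. [folklore] -/
theorem contDiff_comp_sub_const {E : Type*} [NormedAddCommGroup E] [NormedSpace ℝ E]
    {f : Config N → E} {n : WithTop ℕ∞} (hf : ContDiff ℝ n f) (c : Config N) :
    ContDiff ℝ n (fun Z : Config N => f (Z - c)) :=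
  hf.comp (contDiff_id.sub contDiff_const)

/-- The pair interaction is invariant under rigid shifts (all particles translated by the same
vector). [folklore] -/
theorem interaction_sub_rigid (v : ℝ → ℝ≥0∞) (X : Config N) (y : Space) :
    interaction v (X - fun _ : Fin N => y) = interaction v X := by
  unfold interaction
  refine Finset.sum_congr rfl fun i _ => Finset.sum_congr rfl fun j _ => ?_
  congr 1
  change dist (X i - y) (X j - y) = dist (X i) (X j)
  rw [dist_eq_norm, dist_eq_norm, sub_sub_sub_cancel_right]

/-- The rigid direction scaled: `t • 𝟙ₐ` is the constant configuration `(t eₐ, …, t eₐ)`. [folklore] -/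
theorem smul_rigid_eq_const (t : ℝ) (a : Fin 3) :
    (t • (fun _ : Fin N => EuclideanSpace.single a (1 : ℝ)) : Config N) =
      fun _ : Fin N => t • EuclideanSpace.single a (1 : ℝ) := rfl

/-- The interaction is invariant under `X ↦ X - t𝟙ₐ`. [folklore] -/
theorem interaction_sub_smul_rigid (v : ℝ → ℝ≥0∞) (X : Config N) (t : ℝ) (a : Fin 3) :
    interaction v (X - t • (fun _ : Fin N => EuclideanSpace.single a (1 : ℝ))) = interaction v X := by
  rw [smul_rigid_eq_const, interaction_sub_rigid]

/-- Support bookkeeping: if `X` is outside the enlarged box `Λ_{L₀+2τ}^N` and `t ∈ [0, 2τ]`, then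
`X - t𝟙ₐ` is outside `Λ_{L₀}^N`. [folklore] -/
theorem sub_smul_notMem_boxN {L₀ τ t : ℝ} (ht0 : 0 ≤ t) (ht : t ≤ 2 * τ) (a : Fin 3) {X : Config N}
    (hX : X ∉ boxN N (L₀ + 2 * τ)) :
    X - t • (fun _ : Fin N => EuclideanSpace.single a (1 : ℝ)) ∉ boxN N L₀ := by
  intro hmem
  apply hX
  intro i k
  have h := hmem i k
  have happ : (X - t • (fun _ : Fin N => EuclideanSpace.single a (1 : ℝ))) i k =
      X i k - t * (if k = a then 1 else 0) := by
    simp [EuclideanSpace.single, PiLp.single_apply]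
  rw [happ] at h
  rw [Set.mem_Ioo] at h ⊢
  by_cases hk : k = a
  · subst hk
    simp only [if_true, mul_one] at h
    constructor <;> linarith [h.1, h.2]
  · simp only [hk, if_false, mul_zero, sub_zero] at h
    constructor <;> linarith [h.1, h.2]

/-! ### Tonelli and translation invariance -/

/-- Joint measurability of `(X, t) ↦ k(X - t𝟙) φ(t)`. [folklore] -/
theorem measurable_shift_mul {k : Config N → ℝ≥0∞} (hk : Measurable k) {φ : ℝ → ℝ≥0∞}
    (hφ : Measurable φ) (D : Config N) :
    Measurable fun p : Config N × ℝ => k (p.1 - p.2 • D) * φ p.2 := by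
  refine (hk.comp ?_).mul (hφ.comp measurable_snd)
  exact (continuous_fst.sub (continuous_snd.smul continuous_const)).measurable

/-- **Tonelli + translation invariance**: for measurable `k ≥ 0` on `(ℝ³)^N` and `φ ≥ 0` on `ℝ`,
`∫ dX ∫_S k(X - tD) φ(t) dt = (∫_S φ) · ∫ k`. [folklore] -/
theorem lintegral_lintegral_shift {k : Config N → ℝ≥0∞} (hk : Measurable k) {φ : ℝ → ℝ≥0∞}
    (hφ : Measurable φ) (D : Config N) (S : Set ℝ) :
    ∫⁻ X, ∫⁻ t in S, k (X - t • D) * φ t = (∫⁻ t in S, φ t) * ∫⁻ X, k X := by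
  rw [lintegral_lintegral_swap ((measurable_shift_mul hk hφ D).aemeasurable)]
  have h : ∀ t : ℝ, ∫⁻ X, k (X - t • D) * φ t = φ t * ∫⁻ X, k X := fun t => by
    have hm : Measurable fun X : Config N => k (X - t • D) :=
      hk.comp (measurable_id.sub measurable_const)
    rw [lintegral_mul_const _ hm, lintegral_sub_right_eq_self k (t • D), mul_comm]
  simp_rw [h]
  rw [lintegral_mul_const _ hφ]

/-! ### Cauchy–Schwarz for the square of a real integral -/

/-- `ofReal (r²) = ‖r‖ₑ²` for real `r` (registered sub-goal anchoring this helper file on the crux item).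
[folklore] -/
theorem ofReal_sq_eq_enorm_sq : ∀ r : ℝ, ENNReal.ofReal (r ^ 2) = (‖r‖ₑ) ^ 2 := by
  intro r
  rw [Real.enorm_eq_ofReal_abs, ← ENNReal.ofReal_pow (abs_nonneg r), sq_abs]

/-- **Cauchy–Schwarz bound for a real integral in `ℝ≥0∞`.** If `‖φ(t)‖ₑ ≤ c · p(t) · q(t)` on `S` then
`ofReal ((∫_S φ)²) ≤ c² (∫_S p²)(∫_S q²)`. [folklore] -/
theorem ofReal_sq_integral_le {S : Set ℝ} {φ : ℝ → ℝ} {p q : ℝ → ℝ≥0∞}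
    (hp : Measurable p) (hq : Measurable q) (c : ℝ≥0∞)
    (h : ∀ t ∈ S, ‖φ t‖ₑ ≤ c * p t * q t) :
    ENNReal.ofReal ((∫ t in S, φ t) ^ 2) ≤ c ^ 2 * ((∫⁻ t in S, p t ^ 2) * ∫⁻ t in S, q t ^ 2) := by
  rw [ofReal_sq_eq_enorm_sq]
  calc (‖∫ t in S, φ t‖ₑ) ^ 2 ≤ (∫⁻ t in S, ‖φ t‖ₑ) ^ 2 := by
        gcongr
        exact enorm_integral_le_lintegral_enorm _
    _ ≤ (∫⁻ t in S, c * (p t * q t)) ^ 2 := by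
        have hle : ∫⁻ t in S, ‖φ t‖ₑ ≤ ∫⁻ t in S, c * (p t * q t) :=
          setLIntegral_mono ((hp.mul hq).const_mul c) fun t ht => by
            rw [← mul_assoc]; exact h t ht
        gcongr
    _ = c ^ 2 * (∫⁻ t in S, p t * q t) ^ 2 := by
        rw [lintegral_const_mul c (show Measurable (fun t => p t * q t) from hp.mul hq), mul_pow]
    _ ≤ c ^ 2 * ((∫⁻ t in S, p t ^ 2) * ∫⁻ t in S, q t ^ 2) := by
        gcongr
        exact lintegral_mul_sq_le _ hp.aemeasurable hq.aemeasurable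

/-! ### Arithmetic of the normalisation -/

/-- **Normalisation arithmetic.** If `1 ≤ m + b` with `b ≤ 1/2` and `b Q ≤ s/2`, then
`m⁻¹ Q ≤ Q + s`. (Used with `m = ‖Θ_η‖₂² ∈ [1 - b, 1]`.) [folklore] -/
theorem inv_mul_le_add_of_le {m b Q s : ℝ≥0∞} (hm1 : 1 ≤ m + b) (hb : b ≤ 2⁻¹)
    (hbQ : b * Q ≤ s / 2) : m⁻¹ * Q ≤ Q + s := by
  -- `m ≥ 1/2`, in particular `m ≠ 0`
  have hm_half : 2⁻¹ ≤ m := by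
    have h1 : (1 : ℝ≥0∞) ≤ m + 2⁻¹ := hm1.trans (add_le_add le_rfl hb)
    have h2 : (1 : ℝ≥0∞) = 2⁻¹ + 2⁻¹ := ENNReal.inv_two_add_inv_two.symm
    rw [h2] at h1
    exact (ENNReal.add_le_add_iff_right (show (2⁻¹ : ℝ≥0∞) ≠ ⊤ by norm_num)).1 h1
  have hm0 : m ≠ 0 := (lt_of_lt_of_le (by norm_num) hm_half).ne'
  rcases eq_or_ne m ⊤ with hmt | hmt
  · simp [hmt]
  -- it suffices to show `Q ≤ m (Q + s)`
  rw [ENNReal.inv_mul_le_iff hm0 hmt]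
  calc Q = 1 * Q := (one_mul Q).symm
    _ ≤ (m + b) * Q := by gcongr
    _ = m * Q + b * Q := by ring
    _ ≤ m * Q + s / 2 := by gcongr
    _ = m * Q + 2⁻¹ * s := by rw [div_eq_mul_inv, mul_comm s]
    _ ≤ m * Q + m * s := by gcongr
    _ = m * (Q + s) := by ring

end SmearStep

end Summit.AtomisticToContinuum.BoseEinsteinCondensation.Theorems.RigidMomentumBound

end
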